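/-
Copyright (c) 2026 H21 harness. All rights reserved.
Released under Apache 2.0 license as described in the file LICENSE.
-/
import Mathlib
import Summits.ResolutionOfSingularities.ResolutionOfSingularities.Theorems.FrobeniusClosingSteerSingularTrace
import Summits.ResolutionOfSingularities.ResolutionOfSingularities.Theorems.FrobeniusClosingSteerDerivationExit

/-!
# Frobenius-closing steer — derivation criterion, Stage (B): `D ^ p = 0` on `K = Frac (A₀[t])`

Context: Steer crux `stmt-ResolutionOfSingularities-16345`, card `singular-trace-constructor` (constructor search for a
NON-REGULAR realisation of the core object `A = A₀[t] ∩ 𝒪_v`), DERIVATION CRITERION.  Stage (A)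
(`FrobeniusClosingSteerDerivationTaylor`) and Stage (C) (`FrobeniusClosingSteerDerivationExit`) take as an explicit hypothesis that
the derivation `D` is NILPOTENT of echelon `p` on the candidate ring `S` (`hDp : ∀ s ∈ S, (D ^ p) s = 0`).  This file DISCHARGES that
hypothesis from the field-theoretic data of the core alone:

* `pow_char_apply_eq_zero_of_adjoin` — if `K` is the fraction field of `k[A₀, t]` (`IsFractionRing (Algebra.adjoin k (insert t A₀)) K`),
  `K` has characteristic `p`, `D : Derivation k K K` kills `A₀`, and `D y = 1` for SOME `y ∈ K`, then `(D ^ p) x = 0` for EVERY `x ∈ K`.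

No hypothesis `t ^ p ∈ A₀`, no degree count and no intermediate field is needed; the proof is the following elementary calculus.

* `pow_apply_mul_eq_sum` — the general LEIBNIZ rule `D^n (a b) = ∑_{i+j=n} (n choose i) Dⁱ a Dʲ b`;
  `pow_char_apply_mul` — in characteristic `p` the middle binomials vanish, so `E := D ^ p` again satisfies the Leibniz rule.
* For ANY `k`-linear map `E` with the Leibniz rule (`lin_apply_one`, `lin_apply_pow`, `lin_apply_inv`, `lin_apply_eval`):
  `E 1 = 0`, `E (t ^ i) = i t^(i-1) E t`, `E x⁻¹ = -x⁻² E x`, and `E (q.eval t) = q'.eval t · E t` when `E` kills the coefficients of `q`.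
* `exists_factor` — consequently every `x ∈ K = Frac (A₀[t])` has a factor `c_x ∈ K` with `E x = c_x · E t` for EVERY Leibniz
  `k`-linear `E` killing `A₀` (write `x = a / b` with `a, b` polynomials in `t` over `A₀`).
* Conclusion: with `E := D ^ p` (Leibniz by `pow_char_apply_mul`, kills `A₀` since `D` does): `E y = D^(p-1) (D y) = D^(p-1) 1 = 0`, while
  `D y = c_y · D t = 1` forces `c_y ≠ 0`; hence `E t = 0` from `E y = c_y · E t`, and then `E x = c_x · E t = 0` for all `x`.
* `exitAt_of_derivation` — the DERIVATION CRITERION with the nilpotency clause discharged: Stage (C)'s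
  `DerivationExit.exitAt_of_derivation_unit` fed with `pow_char_apply_eq_zero_of_adjoin`.  For a regular local `S ≤ K = Frac (A₀[t])`
  containing `k`, a `k`-derivation `D` of `K` with `D(S) ⊆ S`, `D(A₀) = 0` and `D y = 1` for some `y ∈ 𝔪_S`, the constants
  `R = S ∩ ker D` (object-free: `hR`) satisfy `ExitAt R p t'` for every `t' ∈ S` (and `R` is regular local by Stage (C)).

Informal source: none beyond folklore (`(d/dt)^p = 0` in characteristic `p`); consult res-L0-w41-strat-1 2026-08-27 (3).
-/

open Polynomial

set_option linter.dupNamespace false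

namespace Summit.ResolutionOfSingularities.ResolutionOfSingularities.Theorems.SwitchingDichotomy

namespace DerivationExit

variable {k K : Type} [Field k] [Field K] [Algebra k K]

/-! ## The general Leibniz rule and its characteristic-`p` specialisation -/

/-- **General Leibniz rule**: `Dⁿ (a b) = ∑_{i ≤ n} (n choose i) · Dⁱ a · Dⁿ⁻ⁱ b`. [folklore] -/
theorem pow_apply_mul_eq_sum (D : Derivation k K K) (n : ℕ) (a b : K) :
    ((D : K →ₗ[k] K) ^ n) (a * b) =
      ∑ i ∈ Finset.range (n + 1),
        (n.choose i : K) * (((D : K →ₗ[k] K) ^ i) a * ((D : K →ₗ[k] K) ^ (n - i)) b) := by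
  have hsucc : ∀ (m : ℕ) (z : K), ((D : K →ₗ[k] K) ^ (m + 1)) z = D (((D : K →ₗ[k] K) ^ m) z) := by
    intro m z
    rw [pow_succ', Module.End.mul_apply, Derivation.coeFn_coe]
  induction n with
  | zero => simp
  | succ n ih =>
    rw [Finset.sum_choose_succ_mul (fun i j => ((D : K →ₗ[k] K) ^ i) a * ((D : K →ₗ[k] K) ^ j) b) n,
      hsucc, ih, map_sum, ← Finset.sum_add_distrib]
    refine Finset.sum_congr rfl fun i hi => ?_
    have hin : n + 1 - i = n - i + 1 := by
      rw [Finset.mem_range] at hi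
      omega
    rw [hin, Derivation.leibniz, Derivation.leibniz, Derivation.map_natCast, smul_zero, add_zero, smul_eq_mul,
      smul_eq_mul, smul_eq_mul, ← hsucc, ← hsucc]
    ring

/-- **Leibniz rule for `D ^ p` in characteristic `p`**: the binomials `(p choose i)`, `0 < i < p`, vanish. [folklore] -/
theorem pow_char_apply_mul (p : ℕ) [Fact p.Prime] [CharP K p] (D : Derivation k K K) (a b : K) :
    ((D : K →ₗ[k] K) ^ p) (a * b) = a * ((D : K →ₗ[k] K) ^ p) b + b * ((D : K →ₗ[k] K) ^ p) a := by
  have hp : p.Prime := Fact.out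
  obtain ⟨m, hm⟩ : ∃ m, p = m + 1 := ⟨p - 1, (Nat.sub_add_cancel hp.one_le).symm⟩
  rw [pow_apply_mul_eq_sum, hm, Finset.sum_range_succ, Finset.sum_range_succ', Finset.sum_eq_zero, zero_add]
  · simp only [Nat.choose_self, Nat.cast_one, one_mul, Nat.sub_self, pow_zero, Module.End.one_apply,
      Nat.choose_zero_right, Nat.sub_zero]
    ring
  · intro i hi
    rw [Finset.mem_range] at hi
    have hdvd : p ∣ (m + 1).choose (i + 1) := by
      rw [← hm]
      exact hp.dvd_choose_self (Nat.succ_ne_zero i) (by omega)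
    rw [(CharP.cast_eq_zero_iff K p _).mpr hdvd, zero_mul]

/-- If `D a = 0` then `Dⁿ a = 0` for `n ≥ 1`. [folklore] -/
theorem pow_succ_apply_eq_zero (D : Derivation k K K) (n : ℕ) {a : K} (ha : D a = 0) :
    ((D : K →ₗ[k] K) ^ (n + 1)) a = 0 := by
  rw [pow_succ, Module.End.mul_apply, Derivation.coeFn_coe, ha, map_zero]

/-! ## Calculus of a Leibniz `k`-linear map -/

section Leibniz

variable (E : K →ₗ[k] K) (hE : ∀ a b : K, E (a * b) = a * E b + b * E a)
include hE

/-- A Leibniz map kills `1`. [folklore] -/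
theorem lin_apply_one : E 1 = 0 := by
  have h := hE 1 1
  rw [one_mul, one_mul] at h
  linear_combination -h

/-- A Leibniz map on powers: `E (t ^ i) = i · t ^ (i - 1) · E t`. [folklore] -/
theorem lin_apply_pow (t : K) (i : ℕ) : E (t ^ i) = (i : K) * t ^ (i - 1) * E t := by
  induction i with
  | zero => rw [pow_zero, lin_apply_one E hE, Nat.cast_zero, zero_mul, zero_mul]
  | succ i ih =>
    rw [pow_succ, hE, ih, Nat.add_sub_cancel, Nat.cast_succ]
    rcases Nat.eq_zero_or_pos i with rfl | hi
    · simp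
    · obtain ⟨j, rfl⟩ : ∃ j, i = j + 1 := ⟨i - 1, (Nat.sub_add_cancel hi).symm⟩
      rw [Nat.add_sub_cancel, pow_succ]
      ring

/-- A Leibniz map on inverses: `E x⁻¹ = -(x⁻¹ · x⁻¹ · E x)`. [folklore] -/
theorem lin_apply_inv (x : K) : E x⁻¹ = -(x⁻¹ * x⁻¹ * E x) := by
  by_cases hx : x = 0
  · rw [hx, inv_zero, map_zero, mul_zero, neg_zero]
  have h := hE x x⁻¹
  rw [mul_inv_cancel₀ hx, lin_apply_one E hE] at h
  have h' : x * (E x⁻¹ + x⁻¹ * x⁻¹ * E x) = 0 := by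
    rw [mul_add, ← mul_assoc, ← mul_assoc, mul_inv_cancel₀ hx, one_mul]
    linear_combination -h
  rcases mul_eq_zero.mp h' with h0 | h0
  · exact absurd h0 hx
  · linear_combination h0

/-- A Leibniz map on a polynomial expression whose coefficients it kills: `E (q.eval t) = q'.eval t · E t`. [folklore] -/
theorem lin_apply_eval (t : K) (q : K[X]) (hq : ∀ i, E (q.coeff i) = 0) :
    E (q.eval t) = (derivative q).eval t * E t := by
  rw [eval_eq_sum, Polynomial.sum_def, map_sum, derivative_eval, Polynomial.sum_def, Finset.sum_mul]
  refine Finset.sum_congr rfl fun n _ => ?_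
  rw [hE, hq n, mul_zero, add_zero, lin_apply_pow E hE]
  ring

end Leibniz

/-! ## Uniform factorisation `E x = c_x · E t` on `K = Frac (A₀[t])` -/

/-- **Uniform factor**: on the fraction field `K` of `k[A₀, t]`, every `x` has a factor `c` with `E x = c · E t` for EVERY Leibniz
`k`-linear map `E` killing `A₀`. [folklore] -/
theorem exists_factor (A₀ : Subalgebra k K) (t : K)
    [IsFractionRing (Algebra.adjoin k (insert t (A₀ : Set K))) K] (x : K) :
    ∃ c : K, ∀ E : K →ₗ[k] K, (∀ a b : K, E (a * b) = a * E b + b * E a) → (∀ a ∈ A₀, E a = 0) →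
      E x = c * E t := by
  obtain ⟨a, b, -, hab⟩ := IsFractionRing.div_surjective (A := Algebra.adjoin k (insert t (A₀ : Set K))) x
  obtain ⟨qa, hqa, hqat⟩ := SingularTrace.exists_polynomial_of_mem_adjoin A₀ t a.2
  obtain ⟨qb, hqb, hqbt⟩ := SingularTrace.exists_polynomial_of_mem_adjoin A₀ t b.2
  refine ⟨(a : K) * -(((b : K))⁻¹ * ((b : K))⁻¹ * (derivative qb).eval t) + ((b : K))⁻¹ * (derivative qa).eval t,
    fun E hE hEA => ?_⟩
  have hxa : x = (a : K) * ((b : K))⁻¹ := by rw [← hab, div_eq_mul_inv]; rfl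
  rw [hxa, hE, lin_apply_inv E hE, ← hqat, ← hqbt, lin_apply_eval E hE t qa fun i => hEA _ (hqa i),
    lin_apply_eval E hE t qb fun i => hEA _ (hqb i), hqat, hqbt]
  ring

/-! ## Nilpotency `D ^ p = 0` -/

/-- **`D ^ p = 0` on `K = Frac (A₀[t])`** in characteristic `p`, for every `k`-derivation `D` of `K` killing `A₀` with `D y = 1` for some
`y`. [folklore] -/
theorem pow_char_apply_eq_zero_of_adjoin (p : ℕ) [Fact p.Prime] [CharP K p] (A₀ : Subalgebra k K) (t : K)
    [IsFractionRing (Algebra.adjoin k (insert t (A₀ : Set K))) K] (D : Derivation k K K)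
    (hDA : ∀ a ∈ A₀, D a = 0) {y : K} (hy : D y = 1) (x : K) : ((D : K →ₗ[k] K) ^ p) x = 0 := by
  have hp : p.Prime := Fact.out
  obtain ⟨m, hm⟩ : ∃ m, p = m + 1 := ⟨p - 1, (Nat.sub_add_cancel hp.one_le).symm⟩
  -- the two Leibniz maps `D` and `E := D ^ p`
  have hD : ∀ a b : K, (D : K →ₗ[k] K) (a * b) = a * (D : K →ₗ[k] K) b + b * (D : K →ₗ[k] K) a := by
    intro a b
    rw [Derivation.coeFn_coe, Derivation.leibniz, smul_eq_mul, smul_eq_mul]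
  have hDA' : ∀ a ∈ A₀, (D : K →ₗ[k] K) a = 0 := fun a ha => by rw [Derivation.coeFn_coe, hDA a ha]
  have hE := pow_char_apply_mul p D
  have hEA : ∀ a ∈ A₀, ((D : K →ₗ[k] K) ^ p) a = 0 := fun a ha => by
    rw [hm]; exact pow_succ_apply_eq_zero D m (hDA a ha)
  -- `E y = 0`
  have hEy : ((D : K →ₗ[k] K) ^ p) y = 0 := by
    obtain ⟨m', hm'⟩ : ∃ m', m = m' + 1 := ⟨m - 1, (Nat.sub_add_cancel (by have := hp.two_le; omega)).symm⟩
    rw [hm, pow_succ, Module.End.mul_apply, Derivation.coeFn_coe, hy, hm']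
    exact pow_succ_apply_eq_zero D m' D.map_one_eq_zero
  -- `E t = 0` from the uniform factor of `y`
  obtain ⟨cy, hcy⟩ := exists_factor A₀ t y
  have h1 : cy * D t = 1 := by rw [← hy, ← Derivation.coeFn_coe, hcy _ hD hDA', Derivation.coeFn_coe]
  have hEt : ((D : K →ₗ[k] K) ^ p) t = 0 := by
    have h := hcy _ hE hEA
    rw [hEy] at h
    rcases mul_eq_zero.mp h.symm with h0 | h0
    · rw [h0, zero_mul] at h1; exact absurd h1 zero_ne_one
    · exact h0
  obtain ⟨cx, hcx⟩ := exists_factor A₀ t x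
  rw [hcx _ hE hEA, hEt, mul_zero]

/-! ## The derivation criterion, nilpotency discharged -/

open IsLocalRing Summit.ResolutionOfSingularities.ResolutionOfSingularities.Theorems.SwitchingDichotomy.Words in
/-- **DERIVATION CRITERION.**  Let `K = Frac (k[A₀, t])` have characteristic `p`, let `S ≤ K` be a REGULAR LOCAL subring containing `k`,
and let `D` be a `k`-derivation of `K` with `D(S) ⊆ S`, `D(A₀) = 0` and `D y = 1` for some `y ∈ 𝔪_S`.  Then the ring of constants
`R = S ∩ ker D` is an exit stage for every `t' ∈ S`: `ExitAt R p t'` (`R` regular local with `y ^ p ∈ 𝔪_R ∖ 𝔪_R²`, `t' ∈ R[y]`).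
Stage (C) `exitAt_of_derivation_unit` with its nilpotency clause supplied by `pow_char_apply_eq_zero_of_adjoin`. [folklore] -/
theorem exitAt_of_derivation (p : ℕ) [Fact p.Prime] [CharP K p] (A₀ : Subalgebra k K) (t : K)
    [IsFractionRing (Algebra.adjoin k (insert t (A₀ : Set K))) K] (S : Subring K) (D : Derivation k K K)
    (hDS : ∀ s ∈ S, D s ∈ S) (hkS : ∀ c : k, algebraMap k K c ∈ S) (hDA : ∀ a ∈ A₀, D a = 0)
    {y : K} (hyS : y ∈ S) (hy : D y = 1) (R : Subring K) (hR : ∀ x, x ∈ R ↔ x ∈ S ∧ D x = 0)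
    [IsRegularLocalRing S] (hym : (⟨y, hyS⟩ : S) ∈ maximalIdeal S) {t' : K} (ht' : t' ∈ S) : ExitAt R p t' :=
  exitAt_of_derivation_unit p S D hDS hkS hyS hy (fun s _ => pow_char_apply_eq_zero_of_adjoin p A₀ t D hDA hy s) R hR
    hym ht'

open IsLocalRing Summit.ResolutionOfSingularities.ResolutionOfSingularities.Theorems.SwitchingDichotomy.Words in
/-- **DERIVATION CRITERION, unit form** (the shape asked for by the card author): as `exitAt_of_derivation`, but with `D y` merely a UNIT
of `S` (for some `y ∈ 𝔪_S`) instead of `D y = 1` — rescale `D` by the inverse of that unit, which changes neither `D(S) ⊆ S`, nor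
`D(A₀) = 0`, nor the ring of constants. [folklore] -/
theorem exitAt_of_derivation_isUnit (p : ℕ) [Fact p.Prime] [CharP K p] (A₀ : Subalgebra k K) (t : K)
    [IsFractionRing (Algebra.adjoin k (insert t (A₀ : Set K))) K] (S : Subring K) (D : Derivation k K K)
    (hDS : ∀ s ∈ S, D s ∈ S) (hkS : ∀ c : k, algebraMap k K c ∈ S) (hDA : ∀ a ∈ A₀, D a = 0)
    {y : K} (hyS : y ∈ S) (hu : IsUnit (⟨D y, hDS y hyS⟩ : S)) (R : Subring K) (hR : ∀ x, x ∈ R ↔ x ∈ S ∧ D x = 0)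
    [IsRegularLocalRing S] (hym : (⟨y, hyS⟩ : S) ∈ maximalIdeal S) {t' : K} (ht' : t' ∈ S) : ExitAt R p t' := by
  obtain ⟨w, hw⟩ := hu.exists_left_inv
  have hw' : (w : K) * D y = 1 := by simpa using congrArg Subtype.val hw
  have hw0 : ¬ (w : K) = 0 := fun h => by
    rw [h, zero_mul] at hw'
    exact zero_ne_one hw'
  refine exitAt_of_derivation p A₀ t S ((w : K) • D) (fun s hs => ?_) hkS (fun a ha => ?_) hyS ?_ R (fun x => ?_)
    hym ht'
  · rw [Derivation.smul_apply, smul_eq_mul]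
    exact S.mul_mem w.2 (hDS s hs)
  · rw [Derivation.smul_apply, smul_eq_mul, hDA a ha, mul_zero]
  · rw [Derivation.smul_apply, smul_eq_mul, hw']
  · rw [hR, Derivation.smul_apply, smul_eq_mul, mul_eq_zero, or_iff_right hw0]

end DerivationExit

end Summit.ResolutionOfSingularities.ResolutionOfSingularities.Theorems.SwitchingDichotomy
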